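import Summits.CriticalPhenomena.Ising3DConformalLimit.Theorems.PerfectScreeningCoulombImpliesNontrivialIsothermOfOneArm
import Summits.CriticalPhenomena.Ising3DConformalLimit.Theorems.PerfectScreeningCoulombImpliesNontrivialOfUpperCriticalIsotherm
import Summits.CriticalPhenomena.Ising3DConformalLimit.Theses.ArmHyperscaling
import Literature.Probability.LatticeModels.HighDimPointwiseTriviality
import HarnessLib

/-!
# Strategist payer edge: `OneArmHyperscaling` (item stmt-CriticalPhenomena-15591) ⟹ `CoulombImpliesNontrivial`
# (item stmt-CriticalPhenomena-13885, route PerfectScreening r3)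

Crux-strategist by-product (planner-cstrat-stmt-CriticalPhenomena-13885-s1-0, 2026-08-17; see
`Cruxes/CoulombImpliesNontrivial/STRATEGY-CENSUS.md`, Transfer T3 / Decomposition D1).

Item 15591 of route `ArmHyperscaling` is the ONE-ARM HYPERSCALING bound in its FK-gluing form,
`(⟨σ₀⟩⁺_{Λ_{Kn};β_c})² ≤ C·⟨σ₀σ_{2ne₀}⟩_{β_c}` (wired FK-Ising one-arm to distance `Kn` is at most
a constant times the square root of the critical two-point function at distance `2n`; Tasaki 1987's
hyperscaling inequality saturated). Together with the infrared bound `⟨σ₀σ_x⟩_{β_c} ≤ C₀/‖x‖`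
(`exists_criticalTwoPoint_le_inv_pow`, Fröhlich–Simon–Spencer 1976 / ADS15 (1.5)) and the GKS
antitonicity of plus-box correlations in the box (`isingCorr_plus_le_of_subset`) it gives the
one-arm form consumed by the landed `stub_isothermOfOneArm` (p107945),
`⟨σ₀⟩⁺_{box L;β_c,0} ≤ C'·L^{-1/2}` for all `L ≥ 1`, hence the upper critical isotherm
`m(β_c,h) ≤ A h^{1/5}` (hypothesis-free), hence the crux by `stub_cruxOfUpperCriticalIsotherm`
(p108706). So **r3 is downstream of the existing open item 15591** (in addition to 4945 p115337,
1342 ∨ 0636 p97440, and the line stub S_B p124053/p141675): `coulombImpliesNontrivial_of_oneArmHyperscaling`.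

No new mathematics: bookkeeping of exponents (`(Kn)` vs `L`, `‖2n e₀‖ = 2n`, `L^{-1/2} = 1/√L`).
-/

noncomputable section

namespace Summit.CriticalPhenomena.Ising3DConformalLimit.PerfectScreeningCoulombImpliesNontrivial

open Literature.Probability.LatticeModels Filter Set Finset
open scoped Topology BigOperators

/-- `‖2n·e₀‖_∞ = 2n` on `Site 3`. [folklore] -/
theorem norm_single_two_mul (n : ℕ) : ‖(Pi.single 0 (2 * (n : ℤ)) : Site 3)‖ = 2 * n := by
  rw [Pi.norm_single, Int.norm_eq_abs]
  push_cast
  rw [abs_of_nonneg (by positivity)]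

/-- `2n·e₀ ≠ 0` for `n ≥ 1`. [folklore] -/
theorem single_two_mul_ne_zero {n : ℕ} (hn : 1 ≤ n) : (Pi.single 0 (2 * (n : ℤ)) : Site 3) ≠ 0 := by
  intro h
  have := congrFun h 0
  simp at this
  omega

/-- **Item 15591 ⟹ the one-arm bound `⟨σ₀⟩⁺_{box L} ≤ C' L^{-1/2}`** (infrared bound + GKS box
antitonicity). [cite: FrohlichSimonSpencer1976, infrared bound] -/
theorem oneArmSqrtBound_of_oneArmHyperscaling
    (h : Summit.CriticalPhenomena.Ising3DConformalLimit.Theses.ArmHyperscaling.OneArmHyperscaling) :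
    ∃ C : ℝ, ∀ L : ℕ, 1 ≤ L →
      isingExpect (zdGraph 3) (box 3 L) (criticalBeta 3) 0 .plus (spinAt 0) ≤ C * (L : ℝ) ^ (-(1:ℝ) / 2) := by
  obtain ⟨K, hK, C, hC⟩ := h
  obtain ⟨C₀, hC₀, hIR⟩ := exists_criticalTwoPoint_le_inv_pow (d := 3) le_rfl
  have hβ : 0 ≤ criticalBeta 3 := (criticalBeta_pos_holds (d := 3) (by norm_num)).le
  -- abbreviation for the plus-box magnetisation at the centre
  set a : ℕ → ℝ := fun L => isingExpect (zdGraph 3) (box 3 L) (criticalBeta 3) 0 .plus (spinAt 0) with ha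
  have ha_corr : ∀ L, a L = isingCorr (zdGraph 3) (box 3 L) (criticalBeta 3) 0 .plus {0} := by
    intro L; simp [ha, isingCorr]
  have ha_le_one : ∀ L, a L ≤ 1 := fun L => by
    rw [ha_corr]; exact (le_abs_self _).trans (abs_isingCorr_le_one _ _ _ _ _ _)
  -- (1) at the scales `K n`: `a(Kn)² ≤ C G(2n e₀) ≤ C⁺ C₀ / (2n)`
  set C' : ℝ := max C 0 with hC'
  have hC'0 : 0 ≤ C' := le_max_right _ _
  have hsq : ∀ n : ℕ, 1 ≤ n → a (K * n) ^ 2 ≤ C' * C₀ / (2 * n) := by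
    intro n hn
    have h1 := hC n hn
    rw [← ha_corr] at h1
    have hG0 : 0 ≤ criticalTwoPoint 3 (Pi.single 0 (2 * (n : ℤ))) := criticalTwoPoint_nonneg' _
    have hG : criticalTwoPoint 3 (Pi.single 0 (2 * (n : ℤ))) ≤ C₀ / (2 * n) := by
      have h2 := hIR _ (single_two_mul_ne_zero hn)
      have hnorm : ((Site.supNorm (Pi.single 0 (2 * (n : ℤ)) : Site 3) : ℝ)) = 2 * n := by
        rw [← Site.norm_eq_supNorm, norm_single_two_mul]
      simpa [hnorm, div_eq_mul_inv] using h2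
    calc a (K * n) ^ 2 ≤ C * criticalTwoPoint 3 (Pi.single 0 (2 * (n : ℤ))) := h1
      _ ≤ C' * criticalTwoPoint 3 (Pi.single 0 (2 * (n : ℤ))) :=
          mul_le_mul_of_nonneg_right (le_max_left _ _) hG0
      _ ≤ C' * (C₀ / (2 * n)) := mul_le_mul_of_nonneg_left hG hC'0
      _ = C' * C₀ / (2 * n) := by ring
  -- (2) the final constant
  refine ⟨Real.sqrt K + Real.sqrt (C' * C₀ * K), fun L hL => ?_⟩
  have hLpos : (0 : ℝ) < L := by exact_mod_cast hL
  have hrpow : (L : ℝ) ^ (-(1:ℝ) / 2) = (Real.sqrt L)⁻¹ := by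
    rw [show (-(1:ℝ) / 2) = -((1:ℝ) / 2) by ring, Real.rpow_neg hLpos.le, ← Real.sqrt_eq_rpow]
  rw [hrpow]
  have hsqrtL : 0 < Real.sqrt L := Real.sqrt_pos.2 hLpos
  have hKpos : (0 : ℝ) < K := by exact_mod_cast hK
  -- case split on `n := L / K`
  rcases Nat.eq_zero_or_pos (L / K) with hn0 | hnpos
  · -- `L < K`: `a L ≤ 1 ≤ √K / √L`
    have hLK : L < K := by
      by_contra hcon
      push Not at hcon
      have : 1 ≤ L / K := (Nat.one_le_div_iff (by omega)).2 hcon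
      omega
    have h1 : (1 : ℝ) ≤ Real.sqrt K * (Real.sqrt L)⁻¹ := by
      rw [← div_eq_mul_inv, le_div_iff₀ hsqrtL, one_mul]
      exact Real.sqrt_le_sqrt (by exact_mod_cast hLK.le)
    calc a L ≤ 1 := ha_le_one L
      _ ≤ Real.sqrt K * (Real.sqrt L)⁻¹ := h1
      _ ≤ (Real.sqrt K + Real.sqrt (C' * C₀ * K)) * (Real.sqrt L)⁻¹ := by
          gcongr
          exact le_add_of_nonneg_right (Real.sqrt_nonneg _)
  · -- `n = L / K ≥ 1`: box antitonicity + the bound at scale `K n`, and `1/(2n) ≤ K/L`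
    set n : ℕ := L / K with hndef
    have hKnL : K * n ≤ L := by rw [hndef, mul_comm]; exact Nat.div_mul_le_self L K
    have hLlt : L < K * (n + 1) := by
      rw [hndef]; exact Nat.lt_mul_div_succ L (by omega)
    have hmono : a L ≤ a (K * n) := by
      rw [ha_corr, ha_corr]
      exact isingCorr_plus_le_of_subset (zdGraph 3) hβ le_rfl
        (Finset.singleton_subset_iff.2 (zero_mem_box 3 (K * n))) (box_mono 3 hKnL)
    have hbound : a (K * n) ≤ Real.sqrt (C' * C₀ / (2 * n)) := by
      calc a (K * n) ≤ |a (K * n)| := le_abs_self _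
        _ = Real.sqrt (a (K * n) ^ 2) := (Real.sqrt_sq_eq_abs _).symm
        _ ≤ Real.sqrt (C' * C₀ / (2 * n)) := Real.sqrt_le_sqrt (hsq n hnpos)
    -- `1/(2n) ≤ K/L`
    have hn1 : (1 : ℝ) ≤ n := by exact_mod_cast hnpos
    have hfrac : C' * C₀ / (2 * n) ≤ C' * C₀ * K / L := by
      have h2n : (L : ℝ) ≤ 2 * n * K := by
        have : (L : ℝ) < K * (n + 1) := by exact_mod_cast hLlt
        nlinarith
      rw [div_le_div_iff₀ (by positivity) hLpos]
      have hCC : 0 ≤ C' * C₀ := mul_nonneg hC'0 hC₀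
      nlinarith
    calc a L ≤ a (K * n) := hmono
      _ ≤ Real.sqrt (C' * C₀ / (2 * n)) := hbound
      _ ≤ Real.sqrt (C' * C₀ * K / L) := Real.sqrt_le_sqrt hfrac
      _ = Real.sqrt (C' * C₀ * K) * (Real.sqrt L)⁻¹ := by
          rw [Real.sqrt_div (by positivity), div_eq_mul_inv]
      _ ≤ (Real.sqrt K + Real.sqrt (C' * C₀ * K)) * (Real.sqrt L)⁻¹ := by
          gcongr
          exact le_add_of_nonneg_left (Real.sqrt_nonneg _)


/-- **Item 15591 ⟹ the upper critical isotherm** `m(β_c,h) ≤ A h^{1/5}` on `(0, h₀]`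
(hypothesis-free; p107945). [cite: FrohlichSimonSpencer1976, infrared bound] -/
theorem upperCriticalIsotherm_of_oneArmHyperscaling
    (h : Summit.CriticalPhenomena.Ising3DConformalLimit.Theses.ArmHyperscaling.OneArmHyperscaling) :
    ∃ A h₀ : ℝ, 0 < h₀ ∧ ∀ h : ℝ, 0 < h → h ≤ h₀ →
      magnetizationInField 3 (criticalBeta 3) h ≤ A * h ^ ((1:ℝ) / 5) :=
  stub_isothermOfOneArm (oneArmSqrtBound_of_oneArmHyperscaling h)

/-- **PAYER EDGE: item stmt-CriticalPhenomena-15591 (`ArmHyperscaling.OneArmHyperscaling`) implies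
the crux stmt-CriticalPhenomena-13885 (`PerfectScreening.CoulombImpliesNontrivial`)** — by name,
through the landed SketchPub chain (one-arm ⟹ UCI p107945 ⟹ crux p108706). [cite: AizenmanCMP1982, §1 (non-triviality via block spins)] -/
theorem coulombImpliesNontrivial_of_oneArmHyperscaling
    (h : Summit.CriticalPhenomena.Ising3DConformalLimit.Theses.ArmHyperscaling.OneArmHyperscaling) :
    Summit.CriticalPhenomena.Ising3DConformalLimit.Theses.PerfectScreening.CoulombImpliesNontrivial :=
  stub_cruxOfUpperCriticalIsotherm fun _ => upperCriticalIsotherm_of_oneArmHyperscaling h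

end Summit.CriticalPhenomena.Ising3DConformalLimit.PerfectScreeningCoulombImpliesNontrivial

end
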